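/-
Copyright (c) 2026 the pub-hodgecm-mathlib formalisation cell (harness21).  Prover seat hodgecm-mathlib-LH5-p02 (g3): line LH3 (closer stub `stub_N9`, organ J),
brick (M-UNFOLD) PART 2 «QUOTIENT HOMEOMORPHISM» (LH3-plan (g3) deal 2026-09-02T07:54:09Z, RULINGS #8).
-/
import Literature.NumberTheory.Automorphic.ArchInnerFormSemiregularCentralizerBlock   -- ★ p850446 (M-UNFOLD) (u2): `exists_continuousMulEquiv_centralizer_gprimeTorus_semireg`
import Literature.MeasureTheory.Group.InvariantQuotientTransport                         -- ★ `cosetCongrHomeomorph` (coset spaces along a group isomorphism)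
import Literature.MeasureTheory.Group.InvariantQuotientProd                              -- ★ `quotientProdHomeomorph` (`(G₁ × G₂) ⧸ (H₁ × H₂) ≃ₜ (G₁ ⧸ H₁) × (G₂ ⧸ H₂)`)
import Mathlib.Topology.Homeomorph.Lemmas
import HarnessLib

/-!
# The quotient `M′ ⧸ T′` of the centraliser of a semi-regular chart point by the chart torus IS the rank-one quotient `B ⧸ A`
# ((M-UNFOLD) PART 2; Rogawski 1990 §4.12, §8.2 p. 122; Folland 1995 §2.6)

Topic `NumberTheory/Automorphic`; namespaces `Literature.MeasureTheory.Group` (§1, generic) and `Literature.NumberTheory.Automorphic.UnitaryGroup` (§2).  THEOREMS ONLY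
(no `def`, no instance, no notation, no axiom, no named fact, no `sorry`).  Cell `pub/hodgecm-mathlib`, crux H413 (`stmt-HodgeConjecture-24833`), F0∕P3c line LH3
(closer stub `stub_N9`, organ J), (M-UNFOLD) PART 2 = the TOPOLOGICAL half of the unfolding (u1): the binders `Ψ : ↥Z(s) ⧸ T′ ≃ₜ B ⧸ A` and
`hΨ : ∀ b, Ψ⁻¹ ⟦b⟧ = ⟦eM⁻¹ (b, 1)⟧` of ★ `Rogawski1990.ArchChartOrbGBlockReduction` (F0P3-p02, p850417) ∕ `…Split` (F0P3b-p01, p850444), DISCHARGED from ★ PART 1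
`exists_continuousMulEquiv_centralizer_gprimeTorus_semireg` (p850446: `eM : M′ ≃ₜ* B × K` with `eM(T′) = A × ⊤`).  The measure identity `hmap` with its explicit constant `κ` is
the (G′-CANCEL) census of LH3-p03 (g4) (RULINGS #8 (iii)).
HONEST LABEL: HC_CM is proved only modulo the 7 printed citations (2 remaining named inputs: hLiu418 = `stmt-HodgeConjecture-24832`, h413 = `stmt-HodgeConjecture-24833`) until
rung 0 closes; count-neutral topological bookkeeping under organ J of `stub_N9`.

* §1 GENERIC **`exists_quotient_homeomorph_of_map_eq_prod_top`**: for topological groups `G B R`, subgroups `T ≤ G`, `A ≤ B` and an isomorphism of topological groups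
  `e : G ≃ₜ* B × R` with `e(T) = A × ⊤` (as `Subgroup.map`), there is a homeomorphism **`Ψ : G ⧸ T ≃ₜ B ⧸ A`** with `Ψ ⟦g⟧ = ⟦(e g).1⟧` and `Ψ⁻¹ ⟦b⟧ = ⟦e⁻¹ (b, 1)⟧` —
  ★ `cosetCongrHomeomorph e` ≫ ★ `quotientProdHomeomorph A ⊤` ≫ Mathlib `Homeomorph.prodUnique` (the factor `R ⧸ ⊤` is a point).
* §2 **`exists_block_quotient_homeomorph_semireg`** — ★ PART 1 re-exported together with `Ψ`, `hΨ` and `Ψ ⟦g⟧ = ⟦π_B g⟧`: ONE `obtain` gives F0P3-p02's `eM Ψ hΨ` and the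
  data for `hγ` (`γB`, `r₀`) at the compact chart `S′ ∌ w₀`.

## References
* [Rogawski1990] J. D. Rogawski, *Automorphic Representations of Unitary Groups in Three Variables*, Ann. of Math. Stud. 123 (1990), §8.2 p. 122, §4.12.
* [Folland1995] G. B. Folland, *A Course in Abstract Harmonic Analysis* (1995), §2.6 (homogeneous spaces `G ⧸ H`).
* [DeitmarEchterhoff2014] A. Deitmar, S. Echterhoff, *Principles of Harmonic Analysis*, 2nd ed. (2014), Thm. 1.5.3.
-/

set_option autoImplicit false

noncomputable section

open Topology NumberField NumberField.InfinitePlace Matrix Complex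
open Literature.NumberTheory.Rogawski1990 Literature.LinearAlgebra.Matrix
open scoped MatrixGroups Matrix ComplexConjugate Classical

/-! ## §1 Generic: the coset space along `e : G ≃ₜ* B × R` with `e(T) = A × ⊤` -/

namespace Literature.MeasureTheory.Group

section Generic

variable {G B R : Type*} [Group G] [Group B] [Group R] [TopologicalSpace G] [TopologicalSpace B] [TopologicalSpace R]
  [ContinuousMul B] [ContinuousMul R]

/-- **`G ⧸ T ≃ₜ B ⧸ A` along `e : G ≃ₜ* B × R` with `e(T) = A × ⊤`**, with `Ψ ⟦g⟧ = ⟦(e g).1⟧` and `Ψ⁻¹ ⟦b⟧ = ⟦e⁻¹(b, 1)⟧` (the top factor `R ⧸ ⊤` is one point).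
[cite: Folland1995, §2.6] [cite: DeitmarEchterhoff2014, Thm. 1.5.3] -/
theorem exists_quotient_homeomorph_of_map_eq_prod_top (T : Subgroup G) (A : Subgroup B) (e : G ≃ₜ* B × R)
    (hT : Subgroup.map (e : G →* B × R) T = A.prod ⊤) :
    ∃ Ψ : G ⧸ T ≃ₜ B ⧸ A, (∀ g : G, Ψ (QuotientGroup.mk g) = QuotientGroup.mk (e g).1) ∧
      (∀ b : B, Ψ.symm (QuotientGroup.mk b) = QuotientGroup.mk (e.symm (b, 1))) := by
  have hHH' : ∀ g : G, e.toMulEquiv g ∈ A.prod ⊤ ↔ g ∈ T := by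
    intro g
    rw [← hT]
    rw [Subgroup.mem_map]
    constructor
    · rintro ⟨g', hg', hgg'⟩
      have : g' = g := e.injective hgg'
      rw [← this]; exact hg'
    · intro hg
      exact ⟨g, hg, rfl⟩
  let Ψ₁ : G ⧸ T ≃ₜ (B × R) ⧸ A.prod ⊤ := cosetCongrHomeomorph e.toMulEquiv T (A.prod ⊤) hHH' e.continuous e.symm.continuous
  let Ψ₂ : (B × R) ⧸ A.prod ⊤ ≃ₜ (B ⧸ A) × (R ⧸ (⊤ : Subgroup R)) := quotientProdHomeomorph A ⊤
  letI : Unique (R ⧸ (⊤ : Subgroup R)) :=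
    { default := QuotientGroup.mk 1
      uniq := fun x => by
        induction x using QuotientGroup.induction_on with
        | H r => exact QuotientGroup.eq.mpr (Subgroup.mem_top _) }
  let Ψ₃ : (B ⧸ A) × (R ⧸ (⊤ : Subgroup R)) ≃ₜ B ⧸ A := Homeomorph.prodUnique (B ⧸ A) (R ⧸ (⊤ : Subgroup R))
  refine ⟨Ψ₁.trans (Ψ₂.trans Ψ₃), fun g => ?_, fun b => ?_⟩
  · show Ψ₃ (Ψ₂ (Ψ₁ (QuotientGroup.mk g))) = _
    have h1 : Ψ₁ (QuotientGroup.mk g) = QuotientGroup.mk (e g) := rfl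
    have h2 : Ψ₂ (QuotientGroup.mk (e g)) = (QuotientGroup.mk (e g).1, QuotientGroup.mk (e g).2) := rfl
    rw [h1, h2]
    rfl
  · show Ψ₁.symm (Ψ₂.symm (Ψ₃.symm (QuotientGroup.mk b))) = _
    have h3 : Ψ₃.symm (QuotientGroup.mk b) = (QuotientGroup.mk b, QuotientGroup.mk 1) := rfl
    have h2 : Ψ₂.symm (QuotientGroup.mk b, QuotientGroup.mk (1 : R)) = QuotientGroup.mk (b, (1 : R)) := rfl
    have h1 : Ψ₁.symm (QuotientGroup.mk (b, (1 : R))) = QuotientGroup.mk (e.symm (b, 1)) := rfl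
    rw [h3, h2, h1]

end Generic

end Literature.MeasureTheory.Group

/-! ## §2 The LH3 dress: `M′ ⧸ T′ ≃ₜ B ⧸ A` for the centraliser of a semi-regular chart point -/

namespace Literature.NumberTheory.Automorphic.UnitaryGroup

open Literature.MeasureTheory.Group

section Dress

variable (L : Type) [Field L] [NumberField L] [IsCMField L] (α : Fin 3 → L)
  (S' : Finset {w : InfinitePlace L // IsComplex w}) (w₀ : {w : InfinitePlace L // IsComplex w})

set_option maxHeartbeats 400000 in
/-- **(M-UNFOLD) PARTS 1+2 IN ONE `obtain`**: at a semi-regular chart point (★ PART 1's hypotheses) there are a closed commutative `K ≤ T′`, an isomorphism of topological groups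
`e_M : M′ ≃ₜ* B × K` and a homeomorphism **`Ψ : M′ ⧸ T′ ≃ₜ B ⧸ A`** (`T′ = chartTorusG S′` read inside `M′ = Z(gprimeTorus α S′ p)`, `A` = the unit-diagonal torus of
`B = U(σ_{w₀} diag(α (τ₀ 0), α (τ₀ 2)))(ℂ)`) with `Ψ ⟦g⟧ = ⟦(e_M g).1⟧`, **`Ψ⁻¹ ⟦b⟧ = ⟦e_M⁻¹ (b, 1)⟧`**, and ★ PART 1's torus bookkeeping (`g ∈ T′ ↔ (e_M g).1` unit diagonal;
the block of `gprimeTorus α S′ c` is `diag(e^{i c_{w₀,0}}, e^{i c_{w₀,2}})`; its `K`-component is `gprimeTorus α S′ (update c w₀ (0, c_{w₀,1}, 0))`; `e_M(T′) = A × ⊤`) — the binders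
`eM Ψ hΨ` (and the data of `hγ`) of ★ `Rogawski1990.ArchChartOrbGBlockReduction`. [cite: Rogawski1990, §8.2 p. 122; §4.12] [cite: Folland1995, §2.6] -/
theorem exists_block_quotient_homeomorph_semireg (hα : ∀ i, α i ≠ 0) (hS' : ∀ w, w ∈ S' → w ∈ splitChartPlaces L α)
    (hw₀ : w₀ ∉ S') (p : {w : InfinitePlace L // IsComplex w} → Fin 3 → ℝ)
    (h02 : Circle.exp (p w₀ 0) = Circle.exp (p w₀ 2)) (h01 : Circle.exp (p w₀ 0) ≠ Circle.exp (p w₀ 1))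
    (hreg : ∀ w, w ≠ w₀ → w ∉ S' → Function.Injective fun i : Fin 3 => Circle.exp (p w i)) (hregS : ∀ w, w ∈ S' → p w 0 ≠ 0) :
    ∃ (K : Subgroup ↥(Subgroup.centralizer ({gprimeTorus L α S' p} : Set ↥(arch (↥(maximalRealSubfield L)) L (IsCMField.complexConj L) 3 (Matrix.diagonal α)))))
      (e : ↥(Subgroup.centralizer ({gprimeTorus L α S' p} : Set ↥(arch (↥(maximalRealSubfield L)) L (IsCMField.complexConj L) 3 (Matrix.diagonal α)))) ≃ₜ* ↥(unitaryGroupOfForm (starRingEnd ℂ) ((Matrix.diagonal ![α (lineOf (formSign L α w₀) 0), α (lineOf (formSign L α w₀) 2)]).map w₀.1.embedding)) × ↥K)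
      (Ψ : ↥(Subgroup.centralizer ({gprimeTorus L α S' p} : Set ↥(arch (↥(maximalRealSubfield L)) L (IsCMField.complexConj L) 3 (Matrix.diagonal α)))) ⧸ (chartTorusG L α S').subgroupOf (Subgroup.centralizer ({gprimeTorus L α S' p} : Set ↥(arch (↥(maximalRealSubfield L)) L (IsCMField.complexConj L) 3 (Matrix.diagonal α)))) ≃ₜ
        ↥(unitaryGroupOfForm (starRingEnd ℂ) ((Matrix.diagonal ![α (lineOf (formSign L α w₀) 0), α (lineOf (formSign L α w₀) 2)]).map w₀.1.embedding)) ⧸ ((circleDiagonal 2).codRestrict (unitaryGroupOfForm (starRingEnd ℂ) ((Matrix.diagonal ![α (lineOf (formSign L α w₀) 0), α (lineOf (formSign L α w₀) 2)]).map w₀.1.embedding))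
            (circleDiagonal_mem_archLocal_diagonal L 2 ![α (lineOf (formSign L α w₀) 0), α (lineOf (formSign L α w₀) 2)] w₀)).range),
      IsClosed (K : Set ↥(Subgroup.centralizer ({gprimeTorus L α S' p} : Set ↥(arch (↥(maximalRealSubfield L)) L (IsCMField.complexConj L) 3 (Matrix.diagonal α))))) ∧
      (∀ k : ↥(Subgroup.centralizer ({gprimeTorus L α S' p} : Set ↥(arch (↥(maximalRealSubfield L)) L (IsCMField.complexConj L) 3 (Matrix.diagonal α)))), k ∈ K → (k : ↥(arch (↥(maximalRealSubfield L)) L (IsCMField.complexConj L) 3 (Matrix.diagonal α))) ∈ chartTorusG L α S') ∧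
      (∀ k₁, k₁ ∈ K → ∀ k₂, k₂ ∈ K → k₁ * k₂ = k₂ * k₁) ∧
      (∀ g : ↥(Subgroup.centralizer ({gprimeTorus L α S' p} : Set ↥(arch (↥(maximalRealSubfield L)) L (IsCMField.complexConj L) 3 (Matrix.diagonal α)))), Ψ (QuotientGroup.mk g) = QuotientGroup.mk (e g).1) ∧
      (∀ b : ↥(unitaryGroupOfForm (starRingEnd ℂ) ((Matrix.diagonal ![α (lineOf (formSign L α w₀) 0), α (lineOf (formSign L α w₀) 2)]).map w₀.1.embedding)), Ψ.symm (QuotientGroup.mk b) = QuotientGroup.mk (e.symm (b, 1))) ∧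
      (∀ g : ↥(Subgroup.centralizer ({gprimeTorus L α S' p} : Set ↥(arch (↥(maximalRealSubfield L)) L (IsCMField.complexConj L) 3 (Matrix.diagonal α)))), (g : ↥(arch (↥(maximalRealSubfield L)) L (IsCMField.complexConj L) 3 (Matrix.diagonal α))) ∈ chartTorusG L α S' ↔ (((e g).1 : ↥(unitaryGroupOfForm (starRingEnd ℂ) ((Matrix.diagonal ![α (lineOf (formSign L α w₀) 0), α (lineOf (formSign L α w₀) 2)]).map w₀.1.embedding))) : GL (Fin 2) ℂ) ∈ Set.range (circleDiagonal 2)) ∧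
      (∀ c : {w : InfinitePlace L // IsComplex w} → Fin 3 → ℝ,
        (((e ⟨gprimeTorus L α S' c, gprimeTorus_mem_centralizer L α S' p c⟩).1 : ↥(unitaryGroupOfForm (starRingEnd ℂ) ((Matrix.diagonal ![α (lineOf (formSign L α w₀) 0), α (lineOf (formSign L α w₀) 2)]).map w₀.1.embedding))) : GL (Fin 2) ℂ) =
          circleDiagonal 2 ![Circle.exp (c w₀ 0), Circle.exp (c w₀ 2)]) ∧
      (∀ c : {w : InfinitePlace L // IsComplex w} → Fin 3 → ℝ,
        ((((e ⟨gprimeTorus L α S' c, gprimeTorus_mem_centralizer L α S' p c⟩).2 : ↥K) : ↥(Subgroup.centralizer ({gprimeTorus L α S' p} : Set ↥(arch (↥(maximalRealSubfield L)) L (IsCMField.complexConj L) 3 (Matrix.diagonal α))))) : ↥(arch (↥(maximalRealSubfield L)) L (IsCMField.complexConj L) 3 (Matrix.diagonal α))) =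
          gprimeTorus L α S' (Function.update c w₀ ![0, c w₀ 1, 0])) ∧
      Subgroup.map (e : ↥(Subgroup.centralizer ({gprimeTorus L α S' p} : Set ↥(arch (↥(maximalRealSubfield L)) L (IsCMField.complexConj L) 3 (Matrix.diagonal α)))) →* ↥(unitaryGroupOfForm (starRingEnd ℂ) ((Matrix.diagonal ![α (lineOf (formSign L α w₀) 0), α (lineOf (formSign L α w₀) 2)]).map w₀.1.embedding)) × ↥K) ((chartTorusG L α S').subgroupOf (Subgroup.centralizer ({gprimeTorus L α S' p} : Set ↥(arch (↥(maximalRealSubfield L)) L (IsCMField.complexConj L) 3 (Matrix.diagonal α))))) = (((circleDiagonal 2).codRestrict (unitaryGroupOfForm (starRingEnd ℂ) ((Matrix.diagonal ![α (lineOf (formSign L α w₀) 0), α (lineOf (formSign L α w₀) 2)]).map w₀.1.embedding))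
            (circleDiagonal_mem_archLocal_diagonal L 2 ![α (lineOf (formSign L α w₀) 0), α (lineOf (formSign L α w₀) 2)] w₀)).range).prod ⊤ := by
  obtain ⟨K, e, hKc, hKT, hKcomm, hiff, hγB, hγK, hmapT⟩ :=
    exists_continuousMulEquiv_centralizer_gprimeTorus_semireg L α S' w₀ hα hS' hw₀ p h02 h01 hreg hregS
  obtain ⟨Ψ, hΨ, hΨsymm⟩ := exists_quotient_homeomorph_of_map_eq_prod_top _ _ e hmapT
  exact ⟨K, e, Ψ, hKc, hKT, hKcomm, hΨ, hΨsymm, hiff, hγB, hγK, hmapT⟩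

end Dress

end Literature.NumberTheory.Automorphic.UnitaryGroup

end
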